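import Mathlib

/-!
# C4 — TRACE PLATE ×2 : the involution `τ_x = ρ_ab` on `E₆(−2) ⊂ H²(Θ_a ∩ Θ_b, ℤ)` (cell hsemireg-c4-1, gen 32)

Companion plate to `C4-TRACE-PLATE-X2-c4-1-g32.md` (crux `BlochSeedDiscOne`; director R19.662 (1):
independent ×2 of transfer's S3 §3 (T2)–(T4) = `READING2-S3-TRANSFER-g15.md` f4b664178561294a and of the
kernel plate `E6RootLetter.lean` c35c68ad699c1f70).  Mathlib-only; no `sorry`, no `instance`, no `notation`,
no banned options, no `native_decide` (every finite check is `decide` / `decide +kernel`, i.e. axioms ⊆ STD).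

NOTHING here is proved toward HC / HC_CM / HC_AV / №4 / 26512 / 18881 / H2: these are the lattice /
counting certificates behind the memo (evidence and typed checks, not rungs).

Independence from `E6RootLetter.lean`: a DIFFERENT model of `E₆` (the cubic-surface lattice `I^{1,6} ⊃ K^⊥ ≅ E₆(−1)`
instead of `E₈ ∩ {v₆=v₇=v₈}`), a DIFFERENT 4-frame (`e₁−e₂, e₃−e₄, e₅−e₆, 2h−Σe`), the fixed sublattice certified as a
statement over ALL integer vectors (not only a spanning check), the action on the 27 lines, a CONTRAST element of
`O(E₆) ∖ W(E₆)` with the same trace that does fix a root (so «τ ∈ W(E₆)» is load-bearing), and the 56-count done with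
the ODD reference form as well as the even one.

§A  arithmetic of the two Lefschetz numbers (the trace digit `t_E = −2, t_B = −12`) and the holomorphic check.
§B  the genus-4 count `#{m odd : m + x odd} = 56` for every `x ≠ 0` (two encodings) and the Arf translation law.
§C  the cubic-surface model: 72 roots, 27 lines, the involution `w₀`, `w₀ ∈ W` (product of 4 orthogonal reflections),
    `w₀² = 1`, isometry, `w₀ K = K`, trace, `Fix(w₀) ∩ K^⊥ = ℤ⟨f₁,f₂⟩ ≅ A₂(2)(−1)`, no fixed vector of square −2,
    exactly three fixed lines (a tritangent trio), the contrast element.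
§D  the norms available on the fixed sublattice (`4(s² − st + t²)`: 4, 12, 16, 28, …; never 2).
§E  integrality constraints on the 56-sign digit `s(D)` of an invariant letter: `s ≡ 0 (8)`, `≡ 8 (16)` if Klein-linearised.
§F  ×2 of semihom-1 g49 (D6)/(D7): Koszul local characters, local terms ¼ ∕ 1 ∕ 25⁄4 ∕ 9…, the octet equation and its uniqueness.
-/

namespace HsemiregC4.TracePlate

/-! ## §A  Lefschetz arithmetic -/

/-- Betti bookkeeping of `S = Θ ∩ Θ_x` (Krämer): `e = 72`, `b₁ = b₃ = 8`, `b₂ = 86 = 28 + 6 + 52`,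
`b₂ = 2 p_g + h¹¹ = 34 + 52`, signature `(2p_g+1, h¹¹−1) = (35, 51)`, `χ(𝒪) = (K² + e)/12 = (96+72)/12 = 14`. -/
theorem betti_bookkeeping :
    (1 : ℤ) - 8 + 86 - 8 + 1 = 72 ∧ (28 : ℤ) + 6 + 52 = 86 ∧ (2 : ℤ) * 17 + 52 = 86 ∧
    (2 : ℤ) * 17 + 1 = 35 ∧ (52 : ℤ) - 1 = 51 ∧ ((96 : ℤ) + 72) / 12 = 14 ∧ (4 : ℤ) * 24 = 96 ∧ (3 : ℤ) * 24 = 72 ∧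
    Nat.choose 8 2 = 28 := by
  refine ⟨by norm_num, by norm_num, by norm_num, by norm_num, by norm_num, by norm_num, by norm_num, by norm_num,
    by decide⟩

/-- The two Lefschetz numbers as functions of the traces `tE = tr(τ | E₆ ⊗ ℚ)` (rank 6) and `tB = tr(τ | V₋)` (rank 52):
`τ_x` is `+1` on `H⁰, H⁴, H¹ ≅ H³` (rank 8 each, translations act trivially on `H*(X)`) and on `i*H²(X)` (rank 28);
`ρ = −1_X = σ τ` is `−1` on `H¹, H³`, `+1` on `i*H²(X)`, `tE` on `E₆` (σ = +1 there) and `−tB` on `V₋` (σ = −1 there). -/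
theorem lefschetz_expand (tE tB : ℤ) :
    (1 - 8 + (28 + tE + tB) - 8 + 1 = 14 + tE + tB) ∧ (1 + 8 + (28 + tE - tB) + 8 + 1 = 46 + tE - tB) := by
  constructor <;> ring

/-- THE TRACE DIGIT. `L(τ_x) = 0` (free) and `L(−1_X) = 56` (56 isolated fixed points of index `+1`) force
`tr(τ_x | E₆) = −2` and `tr(τ_x | V₋) = −12`. -/
theorem trace_digit (tE tB : ℤ) (hτ : 14 + tE + tB = 0) (hρ : 46 + tE - tB = 56) : tE = -2 ∧ tB = -12 := by
  omega

/-- Converse bookkeeping: with `tE = −2`, `tB = −12` both Lefschetz numbers come out right, and the traces are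
within the rank bounds `|tE| ≤ 6`, `|tB| ≤ 52` with the parities of involution traces (`tE ≡ 6`, `tB ≡ 52 (mod 2)`). -/
theorem trace_digit_consistent :
    (14 : ℤ) + (-2) + (-12) = 0 ∧ (46 : ℤ) + (-2) - (-12) = 56 ∧ |(-2 : ℤ)| ≤ 6 ∧ |(-12 : ℤ)| ≤ 52 ∧
    (-2 : ℤ) % 2 = 6 % 2 ∧ (-12 : ℤ) % 2 = 52 % 2 := by norm_num

/-- An involution of trace `t` on a rank-`n` lattice has `−1`-multiplicity `(n − t)/2`: on `E₆`, `t = −2 ⇒ 4`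
(so `dim Fix = 2`); on `V₋`, `t = −12 ⇒ 32` (so `dim Fix = 20`). -/
theorem eigen_multiplicities : ((6 : ℤ) - (-2)) / 2 = 4 ∧ ((6 : ℤ) + (-2)) / 2 = 2 ∧
    ((52 : ℤ) - (-12)) / 2 = 32 ∧ ((52 : ℤ) + (-12)) / 2 = 20 := by norm_num

/-- Local index of an isolated fixed point with differential `−I` (real `4 × 4`): `det(I − (−I₄)) = 2⁴ = 16 > 0`,
so each of the 56 points counts `+1` topologically, and `1/det_ℂ(1 − (−I₂)) = 1/4` holomorphically. -/
theorem local_index : (2 : ℤ) ^ 4 = 16 ∧ (0 : ℤ) < 16 ∧ ((1 : ℚ) - (-1)) * (1 - (-1)) = 4 := by norm_num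

/-- Holomorphic Lefschetz check for `ρ = −1_X` on `𝒪_S`: `56 · (1/4) = 14 = 1 − tr(ρ|H^{0,1}) + tr(ρ|H^{0,2})`
with `tr(ρ|H^{0,1}) = −4` (q = 4, ρ = −1) forces `tr(ρ | H^{0,2}) = 9` on `p_g = 17`: eigenvalues `+1^{13}, −1^{4}`;
the `+1^{6}` coming from `H^{2,0}(X)` leaves trace `3` on the 11-dimensional `V₋^{2,0}`, i.e. `+1^7 −1^4` there,
and then `tr(ρ | V₋^{1,1}) = 12 − 2·3 = 6` on dimension `52 − 22 = 30`. All multiplicities are non-negative integers. -/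
theorem holomorphic_lefschetz_consistent :
    (56 : ℚ) / 4 = 14 ∧ (1 : ℤ) - (-4) + 9 = 14 ∧ (13 : ℤ) - 4 = 9 ∧ (13 : ℤ) + 4 = 17 ∧
    (9 : ℤ) - 6 = 3 ∧ (7 : ℤ) - 4 = 3 ∧ (7 : ℤ) + 4 = 11 ∧ (17 : ℤ) - 6 = 11 ∧
    (12 : ℤ) - 2 * 3 = 6 ∧ (52 : ℤ) - 2 * 11 = 30 ∧ (18 : ℤ) - 12 = 6 ∧ (18 : ℤ) + 12 = 30 := by norm_num

/-- On the quotient `S⁺ = S/σ` (σ free): `e = 36`, `χ(𝒪) = 7`, the image involution has `56/2 = 28` fixed points and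
holomorphic Lefschetz number `28/4 = 7 = 1 − 0 + 6` (q(S⁺) = 0, p_g(S⁺) = 6, ρ trivial on `H^{2,0}(X)|`). -/
theorem quotient_bookkeeping : (72 : ℤ) / 2 = 36 ∧ (14 : ℤ) / 2 = 7 ∧ (56 : ℤ) / 2 = 28 ∧ (28 : ℚ) / 4 = 7 ∧
    (1 : ℤ) - 0 + 6 = 7 := by norm_num

/-! ## §B  The 56 fixed points: odd theta characteristics in genus 4

`X[2] = 𝔽₂⁸` with symplectic basis; `v < 256` encodes `(x₁..x₄ ; y₁..y₄)` as bits `0..3 ; 4..7`.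
`q₀(v) = Σ xᵢyᵢ` is the even (Arf 0) reference form, `q₁ = q₀ + x₁ + y₁` an odd (Arf 1) one; the 256 quadratic
forms polarising the Weil pairing `ω` are `q + ω(c, ·)`, `c ∈ 𝔽₂⁸`.  A smooth symmetric `Θ` meets `X[2]` in
`c₀ + {q₀ = 1}` (120 points, the odd characteristics); the fixed points of `−1_X` on `Θ_a ∩ Θ_b` (`a, b ∈ X[2]`,
`x = a + b ≠ 0`) are `(O + a) ∩ (O + b)`, in number `#{m : q₀(m) = 1, q₀(m + x) = 1}`. -/

/-- bit `i` of `v`. -/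
def bit (v i : ℕ) : Bool := Nat.testBit v i

/-- addition in `𝔽₂` on booleans. -/
def xb (p q : Bool) : Bool := p != q

/-- the Weil pairing `ω(u,v) = Σᵢ (uₓᵢ v_yᵢ + u_yᵢ vₓᵢ)` on `𝔽₂⁸`. -/
def omg (u v : ℕ) : Bool :=
  xb (xb (xb (bit u 0 && bit v 4) (bit u 4 && bit v 0)) (xb (bit u 1 && bit v 5) (bit u 5 && bit v 1)))
     (xb (xb (bit u 2 && bit v 6) (bit u 6 && bit v 2)) (xb (bit u 3 && bit v 7) (bit u 7 && bit v 3)))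

/-- the even reference form `q₀ = Σ xᵢ yᵢ`. -/
def q0 (v : ℕ) : Bool :=
  xb (xb (bit v 0 && bit v 4) (bit v 1 && bit v 5)) (xb (bit v 2 && bit v 6) (bit v 3 && bit v 7))

/-- the odd reference form `q₁ = q₀ + x₁ + y₁`. -/
def q1 (v : ℕ) : Bool := xb (xb (q0 v) (bit v 0)) (bit v 4)

/-- the form `q₀ + ω(c,·)`. -/
def qc (c v : ℕ) : Bool := xb (q0 v) (omg c v)

/-- number of `v ∈ 𝔽₂⁸` with `q(v) = 1`. -/
def ones (q : ℕ → Bool) : ℕ := ((List.range 256).filter fun v => q v).length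

/-- `q₀` is even (120 ones, 136 zeros), `q₁` is odd (136 ones). -/
theorem reference_forms : ones q0 = 120 ∧ ones q1 = 136 := by
  constructor <;> decide +kernel

/-- `q₀` is a quadratic refinement of `ω`: `q₀(u + v) = q₀(u) + q₀(v) + ω(u,v)` (addition in `𝔽₂⁸` = `xor`). -/
theorem q0_polar : ((List.range 256).all fun u => (List.range 256).all fun v =>
    q0 (u ^^^ v) == xb (xb (q0 u) (q0 v)) (omg u v)) = true := by decide +kernel

/-- ARF TRANSLATION LAW: `Arf(q₀ + ω(c,·)) = q₀(c)`, i.e. the form `q₀ + ω(c,·)` is odd (136 ones) iff `q₀(c) = 1`,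
and even (120 ones) otherwise — for all 256 `c`. -/
theorem arf_law : ((List.range 256).all fun c =>
    ones (qc c) == (if q0 c then 136 else 120)) = true := by decide +kernel

/-- number of odd points `m` (i.e. `q₀ m = 1`) with `m + x` odd as well. -/
def bothOdd (x : ℕ) : ℕ := ((List.range 256).filter fun m => q0 m && q0 (m ^^^ x)).length

/-- THE COUNT (even encoding): for every `x ≠ 0` in `𝔽₂⁸`, `#{m : q₀(m) = q₀(m+x) = 1} = 56`
(both `O(q₀)`-orbits, `q₀(x) = 0` (135 values of `x`) and `q₀(x) = 1` (120 values), give 56). -/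
theorem count56 : ((List.range 256).all fun x => x == 0 || bothOdd x == 56) = true := by decide +kernel

/-- the same count phrased with characteristics: `#{c : q₀+ω(c,·) odd, (q₀+ω(c,·))(x) = 0} = 56` for `x ≠ 0`
(by `arf_law`, «odd» is `q₀ c = 1`). -/
def oddCharZero (x : ℕ) : ℕ := ((List.range 256).filter fun c => q0 c && !(qc c x)).length

theorem count56_char : ((List.range 256).all fun x => x == 0 || oddCharZero x == 56) = true := by
  decide +kernel

/-- THE COUNT (odd encoding, independent): with the odd reference form, `Θ ∩ X[2] = c₀ + {q₁ = 0}` (120 points) and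
`#{m : q₁(m) = q₁(m + x) = 0} = 56` for every `x ≠ 0`. -/
def bothZeroOdd (x : ℕ) : ℕ := ((List.range 256).filter fun m => !(q1 m) && !(q1 (m ^^^ x))).length

theorem count56_odd : ones (fun v => !(q1 v)) = 120 ∧
    ((List.range 256).all fun x => x == 0 || bothZeroOdd x == 56) = true := by
  constructor <;> decide +kernel

/-- the orbit split of `x ≠ 0` under `O(q₀)`: 135 with `q₀(x) = 0`, 120 with `q₀(x) = 1`; and the pen count
`2 · 28 = 56` (case `q₀ x = 0`: `q₀` descends to `x^⊥/x ≅ 𝔽₂⁶`, even, 28 ones, each lifting twice) resp.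
`120 − 64 = 56` (case `q₀ x = 1`: 64 odd points in `x^⊥`). -/
theorem orbit_split : ((List.range 256).filter fun x => x != 0 && !(q0 x)).length = 135 ∧
    ((List.range 256).filter fun x => q0 x).length = 120 ∧ (2 : ℕ) * 28 = 56 ∧ (120 : ℕ) - 64 = 56 ∧
    2 ^ 2 * (2 ^ 3 - 1) = 28 := by
  refine ⟨by decide +kernel, by decide +kernel, by norm_num, by norm_num, by norm_num⟩

/-! ## §C  The cubic-surface model of `E₆`

`I^{1,6} = ℤh ⊕ ℤe₁ ⊕ ⋯ ⊕ ℤe₆`, form `diag(1,−1,…,−1)`, `K = −3h + Σ eᵢ`, `E₆(−1) = K^⊥`.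
Roots: `v² = −2, v·K = 0` (72); lines: `v² = −1, v·K = −1` (27).  Reflection `s_r(v) = v + (v·r) r`.
List layer (`List ℤ` of length 7, finite checks by `decide`) and variable layer (7 integers, `∀`-statements). -/

/-- the form of signature `(1,6)` on coordinate lists `[a, b₁, …, b₆]`. -/
def dotL (u v : List ℤ) : ℤ := match u, v with
  | a :: us, b :: vs => a * b - (List.zipWith (· * ·) us vs).sum
  | _, _ => 0

/-- canonical class `K = −3h + Σ eᵢ`. -/
def KL : List ℤ := [-3, 1, 1, 1, 1, 1, 1]

/-- reflection in a root `r` (`r² = −2`): `s_r(v) = v + (v·r) r`. -/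
def reflL (r v : List ℤ) : List ℤ := List.zipWith (fun vi ri => vi + dotL v r * ri) v r

/-- the 72 roots: `eᵢ − eⱼ` (30), `±(h − eᵢ − eⱼ − eₖ)` (40), `±(2h − Σe)` (2). -/
def rootsL : List (List ℤ) :=
  -- eᵢ − eⱼ
  ((List.range 6).flatMap fun i => (List.range 6).filterMap fun j =>
      if i = j then none else some (0 :: (List.range 6).map fun k => if k = i then 1 else if k = j then -1 else 0)) ++
  -- ±(h − eᵢ − eⱼ − eₖ), i<j<k
  ((List.range 6).flatMap fun i => (List.range 6).flatMap fun j => (List.range 6).flatMap fun k =>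
      if i < j ∧ j < k then
        [1 :: (List.range 6).map (fun l => if l = i ∨ l = j ∨ l = k then -1 else 0),
         -1 :: (List.range 6).map (fun l => if l = i ∨ l = j ∨ l = k then 1 else 0)]
      else []) ++
  [[2, -1, -1, -1, -1, -1, -1], [-2, 1, 1, 1, 1, 1, 1]]

/-- the 27 lines: `eᵢ` (6), `h − eᵢ − eⱼ` (15), `2h − Σ_{k≠i} e_k` (6). -/
def linesL : List (List ℤ) :=
  ((List.range 6).map fun i => 0 :: (List.range 6).map fun k => if k = i then 1 else 0) ++
  ((List.range 6).flatMap fun i => (List.range 6).flatMap fun j =>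
      if i < j then [1 :: (List.range 6).map fun k => if k = i ∨ k = j then -1 else 0] else []) ++
  ((List.range 6).map fun i => 2 :: (List.range 6).map fun k => if k = i then 0 else -1)

/-- 72 distinct roots, all with `r² = −2`, `r·K = 0`; 27 distinct lines, all with `ℓ² = −1`, `ℓ·K = −1`.
(Completeness: `|Φ(E₆)| = 72` and the 27 exceptional classes are print — Manin / Dolgachev; the lists are distinct
and of the right size.) -/
theorem roots_lines_basic :
    rootsL.length = 72 ∧ rootsL.Nodup ∧ (rootsL.all fun r => dotL r r == -2 && dotL r KL == 0) = true ∧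
    linesL.length = 27 ∧ linesL.Nodup ∧ (linesL.all fun l => dotL l l == -1 && dotL l KL == -1) = true := by
  refine ⟨by decide +kernel, by decide +kernel, by decide +kernel, by decide +kernel, by decide +kernel,
    by decide +kernel⟩

/-- the 4-frame: `r₁ = e₁ − e₂`, `r₂ = e₃ − e₄`, `r₃ = e₅ − e₆`, `r₀ = 2h − Σ eᵢ` — four mutually orthogonal roots. -/
def r1L : List ℤ := [0, 1, -1, 0, 0, 0, 0]
def r2L : List ℤ := [0, 0, 0, 1, -1, 0, 0]
def r3L : List ℤ := [0, 0, 0, 0, 0, 1, -1]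
def r0L : List ℤ := [2, -1, -1, -1, -1, -1, -1]

theorem frame_orthogonal :
    ([r1L, r2L, r3L, r0L].all fun r => decide (r ∈ rootsL)) = true ∧
    dotL r1L r2L = 0 ∧ dotL r1L r3L = 0 ∧ dotL r1L r0L = 0 ∧ dotL r2L r3L = 0 ∧ dotL r2L r0L = 0 ∧ dotL r3L r0L = 0 := by
  refine ⟨by decide +kernel, by decide, by decide, by decide, by decide, by decide, by decide⟩

/-- roots orthogonal to a growing sub-frame: 30 (an `A₅`), 12 (`A₃`), 2 (`A₁`), 0 — so NO root is orthogonal to the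
whole 4-frame, and the ordered-frame count is `72·30·12·2 = 51840 = |W(E₆)|`. -/
def perpCount (S : List (List ℤ)) : ℕ := (rootsL.filter fun r => S.all fun s => dotL r s == 0).length

theorem perp_chain : perpCount [r1L] = 30 ∧ perpCount [r1L, r2L] = 12 ∧ perpCount [r1L, r2L, r3L] = 2 ∧
    perpCount [r1L, r2L, r3L, r0L] = 0 ∧ 72 * 30 * 12 * 2 = 51840 ∧ 51840 = 2 ^ 7 * 3 ^ 4 * 5 := by
  refine ⟨by decide +kernel, by decide +kernel, by decide +kernel, by decide +kernel, by norm_num, by norm_num⟩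

/-- `w₀ = s_{r₁} s_{r₂} s_{r₃} s_{r₀}` (`s_{r₀}` acts first), list layer. -/
def w0L (v : List ℤ) : List ℤ := reflL r1L (reflL r2L (reflL r3L (reflL r0L v)))

/-- the matrix of `w₀` (images of the basis `h, e₁, …, e₆` = the columns): agrees with the variable-layer formula
`w0` below and with the machine census `weylE6.json`. -/
theorem w0L_on_basis :
    [[1,0,0,0,0,0,0],[0,1,0,0,0,0,0],[0,0,1,0,0,0,0],[0,0,0,1,0,0,0],[0,0,0,0,1,0,0],[0,0,0,0,0,1,0],[0,0,0,0,0,0,1]].map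
      w0L =
    [[5,-2,-2,-2,-2,-2,-2],[2,-1,0,-1,-1,-1,-1],[2,0,-1,-1,-1,-1,-1],[2,-1,-1,-1,0,-1,-1],[2,-1,-1,0,-1,-1,-1],
     [2,-1,-1,-1,-1,-1,0],[2,-1,-1,-1,-1,0,-1]] := by decide +kernel

/-- FINITE FACTS about `w₀` on roots and lines: it permutes the 72 roots with NO fixed root (36 orbits of size 2) and
negates exactly 24 of them (the `D₄ ⊃ 4A₁` on which it is `−1`); it permutes the 27 lines fixing EXACTLY the three
lines `h − e₁ − e₂, h − e₃ − e₄, h − e₅ − e₆`, which meet pairwise (a tritangent trio, `Σ = −K`), the other 24 in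
12 swapped pairs. -/
def l1L : List ℤ := [1, -1, -1, 0, 0, 0, 0]
def l2L : List ℤ := [1, 0, 0, -1, -1, 0, 0]
def l3L : List ℤ := [1, 0, 0, 0, 0, -1, -1]

theorem w0_on_roots_and_lines :
    (rootsL.all fun r => decide (w0L r ∈ rootsL) && !(w0L r == r) && w0L (w0L r) == r) = true ∧
    (rootsL.filter fun r => w0L r == r.map (- ·)).length = 24 ∧
    (linesL.all fun l => decide (w0L l ∈ linesL) && w0L (w0L l) == l) = true ∧
    (linesL.filter fun l => w0L l == l) = [l1L, l2L, l3L] ∧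
    dotL l1L l2L = 1 ∧ dotL l1L l3L = 1 ∧ dotL l2L l3L = 1 ∧
    List.zipWith (· + ·) (List.zipWith (· + ·) l1L l2L) l3L = KL.map (- ·) := by
  refine ⟨by decide +kernel, by decide +kernel, by decide +kernel, by decide +kernel, by decide, by decide, by decide,
    by decide⟩

/-- GLUE (why `τ_x ∈ W(E₆)`): `g = 3ℓ₁ + K ∈ K^⊥` and `g/3 = ℓ₁ + K/3` generates `(K^⊥)^*/K^⊥ ≅ ℤ/3` (in `H²(S,ℤ)`:
Krämer's glue vector `λ = θ/3 + β`, `β` a minimal dual vector, Lemma 7.2).  Every root has `g·r ∈ 3ℤ`, so every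
reflection — hence all of `W(E₆)` — moves `g` inside `g + 3K^⊥` (trivial on the glue), while `−1` does not
(`2g ∉ 3ℤ⁷`).  `τ_x` is trivial on `i*H²(X) ∋ θ`, so it is trivial on the glue, so `τ_x|E₆ ∈ W(E₆)`. -/
def gL : List ℤ := [0, -2, -2, 1, 1, 1, 1]

theorem glue_bookkeeping :
    List.zipWith (· + ·) (l1L.map (3 * ·)) KL = gL ∧ dotL gL KL = 0 ∧
    (rootsL.all fun r => dotL gL r % 3 == 0) = true ∧
    (rootsL.all fun r => (List.zipWith (· - ·) (reflL r gL) gL).all fun z => z % 3 == 0) = true ∧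
    ((gL.map (2 * ·)).all fun z => z % 3 == 0) = false ∧
    ((List.zipWith (· - ·) (w0L gL) gL).all fun z => z % 3 == 0) = true := by
  refine ⟨by decide, by decide, by decide +kernel, by decide +kernel, by decide, by decide +kernel⟩

/-! ### variable layer: statements over all of `I^{1,6}` -/

/-- a vector `a h + Σ bᵢ eᵢ` of `I^{1,6}`. (A plain structure: no instances are declared.) -/
structure V where
  a : ℤ
  b1 : ℤ
  b2 : ℤ
  b3 : ℤ
  b4 : ℤ
  b5 : ℤ
  b6 : ℤ

/-- the form `diag(1, −1, …, −1)`. -/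
def dot (u v : V) : ℤ :=
  u.a * v.a - u.b1 * v.b1 - u.b2 * v.b2 - u.b3 * v.b3 - u.b4 * v.b4 - u.b5 * v.b5 - u.b6 * v.b6

/-- `K = −3h + Σ eᵢ`. -/
def K : V := ⟨-3, 1, 1, 1, 1, 1, 1⟩

/-- `w₀` as the explicit linear map (rows of `w0L_on_basis`, transposed = the census matrix). -/
def w0 (v : V) : V :=
  ⟨5 * v.a + 2 * (v.b1 + v.b2 + v.b3 + v.b4 + v.b5 + v.b6),
   -2 * v.a - v.b1 - v.b3 - v.b4 - v.b5 - v.b6,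
   -2 * v.a - v.b2 - v.b3 - v.b4 - v.b5 - v.b6,
   -2 * v.a - v.b1 - v.b2 - v.b3 - v.b5 - v.b6,
   -2 * v.a - v.b1 - v.b2 - v.b4 - v.b5 - v.b6,
   -2 * v.a - v.b1 - v.b2 - v.b3 - v.b4 - v.b5,
   -2 * v.a - v.b1 - v.b2 - v.b3 - v.b4 - v.b6⟩

/-- the four reflections, written out (`s_r(v) = v + (v·r) r`). -/
def s1 (v : V) : V := ⟨v.a, v.b2, v.b1, v.b3, v.b4, v.b5, v.b6⟩
def s2 (v : V) : V := ⟨v.a, v.b1, v.b2, v.b4, v.b3, v.b5, v.b6⟩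
def s3 (v : V) : V := ⟨v.a, v.b1, v.b2, v.b3, v.b4, v.b6, v.b5⟩
/-- `s_{r₀}`, `r₀ = 2h − Σe`: `v·r₀ = 2a + Σ bᵢ`. -/
def s0 (v : V) : V :=
  let c := 2 * v.a + (v.b1 + v.b2 + v.b3 + v.b4 + v.b5 + v.b6)
  ⟨v.a + 2 * c, v.b1 - c, v.b2 - c, v.b3 - c, v.b4 - c, v.b5 - c, v.b6 - c⟩

def r1 : V := ⟨0, 1, -1, 0, 0, 0, 0⟩
def r2 : V := ⟨0, 0, 0, 1, -1, 0, 0⟩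
def r3 : V := ⟨0, 0, 0, 0, 0, 1, -1⟩
def r0 : V := ⟨2, -1, -1, -1, -1, -1, -1⟩

/-- the written-out maps ARE the reflections `v + (v·r) r` in the frame roots. -/
theorem reflections_are_reflections (v : V) :
    s1 v = ⟨v.a + dot v r1 * r1.a, v.b1 + dot v r1 * r1.b1, v.b2 + dot v r1 * r1.b2, v.b3 + dot v r1 * r1.b3,
            v.b4 + dot v r1 * r1.b4, v.b5 + dot v r1 * r1.b5, v.b6 + dot v r1 * r1.b6⟩ ∧
    s2 v = ⟨v.a + dot v r2 * r2.a, v.b1 + dot v r2 * r2.b1, v.b2 + dot v r2 * r2.b2, v.b3 + dot v r2 * r2.b3,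
            v.b4 + dot v r2 * r2.b4, v.b5 + dot v r2 * r2.b5, v.b6 + dot v r2 * r2.b6⟩ ∧
    s3 v = ⟨v.a + dot v r3 * r3.a, v.b1 + dot v r3 * r3.b1, v.b2 + dot v r3 * r3.b2, v.b3 + dot v r3 * r3.b3,
            v.b4 + dot v r3 * r3.b4, v.b5 + dot v r3 * r3.b5, v.b6 + dot v r3 * r3.b6⟩ ∧
    s0 v = ⟨v.a + dot v r0 * r0.a, v.b1 + dot v r0 * r0.b1, v.b2 + dot v r0 * r0.b2, v.b3 + dot v r0 * r0.b3,
            v.b4 + dot v r0 * r0.b4, v.b5 + dot v r0 * r0.b5, v.b6 + dot v r0 * r0.b6⟩ := by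
  obtain ⟨a, b1, b2, b3, b4, b5, b6⟩ := v
  refine ⟨?_, ?_, ?_, ?_⟩ <;> simp only [s1, s2, s3, s0, dot, r1, r2, r3, r0, V.mk.injEq] <;>
    refine ⟨?_, ?_, ?_, ?_, ?_, ?_, ?_⟩ <;> ring

/-- `w₀ = s₁ ∘ s₂ ∘ s₃ ∘ s₀` identically on `I^{1,6}` (so `w₀ ∈ W(E₆)`, a product of four commuting reflections). -/
theorem w0_eq_frame_product (v : V) : w0 v = s1 (s2 (s3 (s0 v))) := by
  obtain ⟨a, b1, b2, b3, b4, b5, b6⟩ := v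
  simp only [w0, s1, s2, s3, s0, V.mk.injEq]
  refine ⟨?_, ?_, ?_, ?_, ?_, ?_, ?_⟩ <;> ring

/-- `w₀` is an involution, an isometry, and fixes `K` (so it preserves `K^⊥ = E₆(−1)`). -/
theorem w0_involution_isometry (u v : V) : w0 (w0 v) = v ∧ dot (w0 u) (w0 v) = dot u v ∧ w0 K = K := by
  obtain ⟨a, b1, b2, b3, b4, b5, b6⟩ := v
  obtain ⟨a', c1, c2, c3, c4, c5, c6⟩ := u
  refine ⟨?_, ?_, rfl⟩
  · simp only [w0, V.mk.injEq]; refine ⟨?_, ?_, ?_, ?_, ?_, ?_, ?_⟩ <;> ring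
  · simp only [w0, dot]; ring

/-- trace of `w₀` on `ℤ⁷` is `5 − 6·1 = −1`; `K` is a `+1`-eigenvector, so the trace on `K^⊥ ⊗ ℚ` is `−1 − 1 = −2`:
`w₀` is in the trace-`−2` class — THE class of `τ_x` by `trace_digit`. (Diagonal entries read off `w0`.) -/
theorem w0_trace : (w0 ⟨1,0,0,0,0,0,0⟩).a + (w0 ⟨0,1,0,0,0,0,0⟩).b1 + (w0 ⟨0,0,1,0,0,0,0⟩).b2 + (w0 ⟨0,0,0,1,0,0,0⟩).b3 +
    (w0 ⟨0,0,0,0,1,0,0⟩).b4 + (w0 ⟨0,0,0,0,0,1,0⟩).b5 + (w0 ⟨0,0,0,0,0,0,1⟩).b6 = -1 ∧ (-1 : ℤ) - 1 = -2 := by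
  constructor <;> decide

/-- the fixed frame: `f₁ = e₁ + e₂ − e₃ − e₄ = −(ℓ₁ − ℓ₂)`, `f₂ = e₃ + e₄ − e₅ − e₆ = −(ℓ₂ − ℓ₃)` for the fixed trio
`ℓ₁ = h−e₁−e₂, ℓ₂ = h−e₃−e₄, ℓ₃ = h−e₅−e₆`. -/
def f1 : V := ⟨0, 1, 1, -1, -1, 0, 0⟩
def f2 : V := ⟨0, 0, 0, 1, 1, -1, -1⟩

/-- Gram matrix of `(f₁, f₂)` in `I^{1,6}`: `[[−4, 2], [2, −4]]`, i.e. `A₂(2)(−1)` = `A₂(−2)` inside `E₆(−1)`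
(in `H²(S, ℤ) ⊃ E₆(−2)` this becomes `A₂(−4)`, norms `−8(s² − st + t²)`); `det = 12 = disc(A₂)·2² `. -/
theorem fixed_frame_gram : dot f1 f1 = -4 ∧ dot f2 f2 = -4 ∧ dot f1 f2 = 2 ∧ (-4 : ℤ) * (-4) - 2 * 2 = 12 ∧
    dot f1 K = 0 ∧ dot f2 K = 0 ∧ w0 f1 = f1 ∧ w0 f2 = f2 := by
  refine ⟨by decide, by decide, by decide, by norm_num, by decide, by decide, rfl, rfl⟩

/-- THE FIXED SUBLATTICE, over all of `K^⊥`: a vector of `E₆(−1) = K^⊥` is fixed by `w₀` iff it lies in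
`ℤ f₁ ⊕ ℤ f₂`; explicitly `v = s f₁ + t f₂ = (0; s, s, t−s, t−s, −t, −t)` with `s = b₁`, `t = b₁ + b₃`. -/
theorem fixed_sublattice (v : V) (hK : dot v K = 0) (hfix : w0 v = v) :
    ∃ s t : ℤ, v = ⟨0, s, s, t - s, t - s, -t, -t⟩ := by
  obtain ⟨a, b1, b2, b3, b4, b5, b6⟩ := v
  have h0 := congrArg V.a hfix
  have h1 := congrArg V.b1 hfix
  have h3 := congrArg V.b3 hfix
  have h5 := congrArg V.b5 hfix
  simp only [w0] at h0 h1 h3 h5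
  simp only [dot, K] at hK
  refine ⟨b1, b1 + b3, ?_⟩
  have ha : a = 0 := by omega
  have e2 : b2 = b1 := by omega
  have e4 : b4 = b3 := by omega
  have e5 : b5 = -(b1 + b3) := by omega
  have e6 : b6 = -(b1 + b3) := by omega
  rw [ha, e2, e4, e5, e6]
  congr 1 <;> omega

/-- conversely every `s f₁ + t f₂` is fixed and lies in `K^⊥`; its square is `−4(s² − st + t²)`, and it IS
`s f₁ + t f₂` coordinatewise. -/
theorem fixed_sublattice_conv (s t : ℤ) :
    w0 ⟨0, s, s, t - s, t - s, -t, -t⟩ = ⟨0, s, s, t - s, t - s, -t, -t⟩ ∧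
    dot ⟨0, s, s, t - s, t - s, -t, -t⟩ K = 0 ∧
    dot ⟨0, s, s, t - s, t - s, -t, -t⟩ ⟨0, s, s, t - s, t - s, -t, -t⟩ = -4 * (s * s - s * t + t * t) ∧
    (⟨0, s, s, t - s, t - s, -t, -t⟩ : V) =
      ⟨s * f1.a + t * f2.a, s * f1.b1 + t * f2.b1, s * f1.b2 + t * f2.b2, s * f1.b3 + t * f2.b3,
       s * f1.b4 + t * f2.b4, s * f1.b5 + t * f2.b5, s * f1.b6 + t * f2.b6⟩ := by
  refine ⟨?_, ?_, ?_, ?_⟩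
  · simp only [w0, V.mk.injEq]; refine ⟨?_, ?_, ?_, ?_, ?_, ?_, ?_⟩ <;> ring
  · simp only [dot, K]; ring
  · simp only [dot]; ring
  · simp only [f1, f2, V.mk.injEq]; refine ⟨?_, ?_, ?_, ?_, ?_, ?_, ?_⟩ <;> ring

/-- NO FIXED ROOT, lattice form: no `w₀`-fixed vector of `K^⊥` has square `−2` (squares on the fixed sublattice are
`≡ 0 (mod 4)`).  Hence `τ_x` fixes no class of square `−4` in `E₆(−2) ⊂ H²(S,ℤ)`: no root letter is `τ_x`-invariant. -/
theorem no_fixed_root (v : V) (hK : dot v K = 0) (hfix : w0 v = v) : dot v v ≠ -2 := by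
  obtain ⟨s, t, rfl⟩ := fixed_sublattice v hK hfix
  have h4 : ∃ k : ℤ, dot ⟨0, s, s, t - s, t - s, -t, -t⟩ ⟨0, s, s, t - s, t - s, -t, -t⟩ = 4 * k :=
    ⟨-(s * s - s * t + t * t), by rw [(fixed_sublattice_conv s t).2.2.1]; ring⟩
  obtain ⟨k, hk⟩ := h4
  intro h
  omega

/-- CONTRAST (why «`τ ∈ W(E₆)`» is load-bearing): `g = −(s₁ s₂)` restricted to `K^⊥` is an isometric involution of
`E₆(−1)` with the SAME trace `−(6 − 2 − 2) = −2` as `w₀`, but it is `−1 · (2A₁) ∉ W(E₆)` and it FIXES the root `r₁`.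
(`−1 ∉ W(E₆)`: it acts as `−1` on the discriminant group `ℤ/3`.)  Kernel part: `g r₁ = r₁`, `g² = 1` on samples,
and the trace bookkeeping. -/
def gContrast (v : V) : V := let u := s1 (s2 v); ⟨-u.a, -u.b1, -u.b2, -u.b3, -u.b4, -u.b5, -u.b6⟩

theorem contrast_fixes_root : gContrast r1 = r1 ∧ gContrast r2 = r2 ∧ dot r1 r1 = -2 ∧ dot r1 K = 0 ∧
    gContrast (gContrast r0) = r0 ∧ gContrast K = ⟨3, -1, -1, -1, -1, -1, -1⟩ ∧ (-(6 - 2 - 2) : ℤ) = -2 := by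
  refine ⟨rfl, rfl, by decide, by decide, rfl, rfl, by norm_num⟩

/-- … and `g` is an isometric involution commuting with nothing special: `g² = 1`, `dot (g u) (g v) = dot u v`
identically (so it is a genuine element of `O(I^{1,6})` preserving `K^⊥`, acting as `−1` on `K`). -/
theorem contrast_involution_isometry (u v : V) : gContrast (gContrast v) = v ∧ dot (gContrast u) (gContrast v) = dot u v := by
  obtain ⟨a, b1, b2, b3, b4, b5, b6⟩ := v
  obtain ⟨a', c1, c2, c3, c4, c5, c6⟩ := u
  refine ⟨?_, ?_⟩
  · simp only [gContrast, s1, s2, V.mk.injEq]; refine ⟨?_, ?_, ?_, ?_, ?_, ?_, ?_⟩ <;> ring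
  · simp only [gContrast, s1, s2, dot]; ring

/-! ## §D  Norms on the invariant sublattice `A₂(2)` (E₆-positive convention: `4(s² − st + t²)`) -/

/-- the binary form `s² − st + t²` on the box `|s|,|t| ≤ 4`: its nonzero values `≤ 7` are exactly `1, 3, 4, 7`
(all four occur) — so the `τ_x`-invariant classes of `E₆(2)` have charges `4, 12, 16, 28, …`, never `2` (no root)
and never `8, 20, 24`.  (The box suffices for values `≤ 7` since `s² − st + t² ≥ (s² + t²)/2`.) -/
def loeschBox : List ℤ :=
  (List.range 9).flatMap fun i => (List.range 9).map fun j =>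
    ((i : ℤ) - 4) * ((i : ℤ) - 4) - ((i : ℤ) - 4) * ((j : ℤ) - 4) + ((j : ℤ) - 4) * ((j : ℤ) - 4)

theorem loeschian_values :
    (loeschBox.all fun n => !(decide (0 < n ∧ n ≤ 7)) || (n == 1 || n == 3 || n == 4 || n == 7)) = true ∧
    (decide (1 ∈ loeschBox) && decide (3 ∈ loeschBox) && decide (4 ∈ loeschBox) && decide (7 ∈ loeschBox)) = true ∧
    (loeschBox.all fun n => !(n == 2) && !(n == 5) && !(n == 6)) = true := by
  refine ⟨by decide +kernel, by decide +kernel, by decide +kernel⟩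

/-- the lower bound behind the box: `2(s² − st + t²) ≥ s² + t²`. -/
theorem loeschian_lower (s t : ℤ) : s * s + t * t ≤ 2 * (s * s - s * t + t * t) := by
  nlinarith [sq_nonneg (s - t)]

/-- positivity away from the origin: `s² − st + t² ≥ 1` unless `s = t = 0`, hence minimal charge `4`. -/
theorem loeschian_pos (s t : ℤ) (h : s ≠ 0 ∨ t ≠ 0) : 1 ≤ s * s - s * t + t * t := by
  rcases h with h | h
  · have hs : 1 ≤ s * s := by nlinarith [sq_nonneg s, Int.one_le_abs h, sq_abs s]
    nlinarith [sq_nonneg (s - 2 * t), sq_nonneg (2 * s - t), sq_nonneg t]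
  · have ht : 1 ≤ t * t := by nlinarith [sq_nonneg t, Int.one_le_abs h, sq_abs t]
    nlinarith [sq_nonneg (s - 2 * t), sq_nonneg (2 * s - t), sq_nonneg s]

/-- index bookkeeping `D₄ ⊕ A₂(2) ⊂ E₆`: `det D₄ · det A₂(2) = 4 · 12 = 48 = 3 · 4²` (index 4), and the class data
of the census: `|W(E₆)| / 45 = 1152 = |W(D₄)| · |S₃|` (centraliser of the `4A₁` involution), `135 · 1 = 45 · 3`
unordered 4-frames (three per involution: triality). -/
theorem index_bookkeeping : (4 : ℕ) * 12 = 3 * 4 ^ 2 ∧ 51840 / 45 = 1152 ∧ 192 * 6 = 1152 ∧ 45 * 3 = 135 ∧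
    51840 / (2 ^ 4 * Nat.factorial 4) = 135 := by
  refine ⟨by norm_num, by norm_num, by norm_num, by norm_num, by decide⟩

/-! ## §E  What integrality says about the 56-sign digit `s(D)` (case (b) strata; pen §5 of the memo)

For a `ρ`-linearised letter `M = 𝒪_S(D)` (`D ∈ A₂(−4)`, charge `n ≡ 0 (mod 4)`, `χ(M) = 14 − n`) the holomorphic
Lefschetz number is `ℓ = L(ρ, M) = s(D)/4`, `s(D) = Σ_p ε_p ∈ [−56, 56]`.  The virtual character `(χ, ℓ)` of `⟨ρ⟩`
has integral multiplicities `(χ ± ℓ)/2`, so `ℓ ≡ χ ≡ 0 (mod 2)`: **`s ≡ 0 (mod 8)`**.  If `M` is linearised for the whole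
Klein group `{1, σ, τ, ρ}` (σ, τ free ⇒ their Lefschetz numbers vanish) the multiplicities are `(χ ± ℓ)/4`, so
`ℓ ≡ −χ ≡ χ (mod 4)`, i.e. `ℓ ≡ 2 (mod 4)`: **`s ≡ 8 (mod 16)`**, `s ∈ {±8, ±24, ±40, 56}` (the sign of `s` is the
choice of linearisation; `−56` would need all 56 weights `−1`). -/

theorem sD_mod8 (n ℓ : ℤ) (hn : 4 ∣ n) (hint : 2 ∣ (14 - n) + ℓ) : 8 ∣ 4 * ℓ := by omega

theorem sD_mod16 (n ℓ : ℤ) (hn : 4 ∣ n) (h1 : 4 ∣ (14 - n) + ℓ) (h2 : 4 ∣ (14 - n) - ℓ) : (4 * ℓ) % 16 = 8 := by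
  omega

/-- the resulting short list: `s = 4ℓ` with `|s| ≤ 56` and `s ≡ 8 (mod 16)`. -/
theorem sD_shortlist (s : ℤ) (hs : s % 16 = 8) (hlo : -56 ≤ s) (hhi : s ≤ 56) :
    s = -56 ∨ s = -40 ∨ s = -24 ∨ s = -8 ∨ s = 8 ∨ s = 24 ∨ s = 40 ∨ s = 56 := by omega

/-- consistency of the trivial letter: `D = 0`, `χ = 14`, `ℓ = 14`, `s = 56`; and of the value `s = 56` for a
charge-4 letter (`χ = 10`, multiplicities `(10 ± 14)/4 ∈ ℤ`: `6` and `−1`). -/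
theorem sD_examples : ((14 : ℤ) + 14) % 4 = 0 ∧ ((14 : ℤ) - 14) % 4 = 0 ∧ (4 : ℤ) * 14 = 56 ∧
    ((10 : ℤ) + 14) / 4 = 6 ∧ ((10 : ℤ) - 14) / 4 = -1 ∧ (56 : ℤ) % 16 = 8 := by norm_num

/-! ## §F  ×2 of semihom-1 g49 (D6)/(D7): Kummer–Lefschetz local terms and the OCTET count (memo §9)

Independent re-derivation (pen in the memo; here the arithmetic).  Holomorphic Lefschetz (Atiyah–Bott ∕ Atiyah–Segal–Singer) at an
isolated fixed point `p` of a reflection `ρ′` (dρ′ = −1 on `T_pX`, `det(1 − dρ′) = 2⁴ = 16`): the `Ext(F,F)`-number receives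
`|ch_{ρ′}(F_p)|² / 16`, where `ch_{ρ′}(F_p) = Σ_i (−1)^i tr(ρ′ | E_i(p))` for an equivariant free resolution `E_• → F_p`.
Koszul characters at a point with all four coordinates odd: `k_p ↦ Σ_i C(4,i) = 16`, `𝒪_S ↦ 1 + 2 + 1 = 4` (`S = {u₁ = u₂ = 0}`),
`I_S·e ↦ ε(1 − 4)`, `m_{S,p} ↦ 4 − 16 = −12` (times the weight of the generator).  For `F = ker(𝒪e₁ ⊕ 𝒪e₂ → 𝒪_S, e_i ↦ t_i·1_S)`
(weight of `1_S` = η₀ = 1): generic stratum point `2 − 4 = −2`; `T₁ △ T₂` point `(−1 + 1) − 4 = −4`; base point `−2 − (−12) = 10`;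
one further point modification `F′ = ker(F → k_p)` of weight `η_Z` subtracts `16 η_Z`, `η_Z` a weight of the fibre `F(p)`:
generic stratum (fibre weights `{+,−,−}`) `−2 ∓ 16 ∈ {−18, 14}`; `T`-point (all `−`) `−4 + 16 = 12`; base point (all five
generators of weight `+`) `10 − 16 = −6`; smooth same-sign `2 − 16 = −14`, smooth opposite-sign `0 ± 16`.
RESULT of the ×2: semihom-1's `¼ ∕ 1 ∕ 25⁄4` and `{9, 49⁄4, 81⁄4}` are confirmed; the list of `Z`-values is completed by
`9⁄4` (Z at a fixed BASE point) and `49⁄4, 16` (Z at a smooth fixed point) — harmless for (D6)/(D7): every local term is `≥ 0`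
and the minimising configuration (`z_fixed = 0`) is unchanged. -/

theorem koszul_characters :
    ((List.range 5).map (Nat.choose 4)).sum = 16 ∧ (1 + 2 + 1 : ℤ) = 4 ∧ (1 : ℤ) * (1 - 4) = -3 ∧ (4 : ℤ) - 16 = -12 := by
  refine ⟨by decide, by norm_num, by norm_num, by norm_num⟩

/-- the sheaf characters `ch(F_p)` (η₀ = 1) and their point modifications. -/
theorem sheaf_characters :
    (2 : ℤ) - 4 = -2 ∧ ((-1 : ℤ) + 1) - 4 = -4 ∧ (-2 : ℤ) - (-12) = 10 ∧
    (-2 : ℤ) - 16 = -18 ∧ (-2 : ℤ) + 16 = 14 ∧ (-4 : ℤ) + 16 = 12 ∧ (10 : ℤ) - 16 = -6 ∧ (2 : ℤ) - 16 = -14 := by norm_num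

/-- local terms `|ch|²/16`: smooth `{0, ¼}`, stratum `¼`, `T`-point `1`, base point `25/4`; with a `Z`-point: `T`-point `9`,
generic stratum `49/4 ∕ 81/4`, base point `9/4`, smooth `49/4 ∕ 16`. -/
theorem local_terms :
    (0 : ℚ) ^ 2 / 16 = 0 ∧ (2 : ℚ) ^ 2 / 16 = 1 / 4 ∧ (4 : ℚ) ^ 2 / 16 = 1 ∧ (10 : ℚ) ^ 2 / 16 = 25 / 4 ∧
    (12 : ℚ) ^ 2 / 16 = 9 ∧ (14 : ℚ) ^ 2 / 16 = 49 / 4 ∧ (18 : ℚ) ^ 2 / 16 = 81 / 4 ∧ (6 : ℚ) ^ 2 / 16 = 9 / 4 ∧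
    (16 : ℚ) ^ 2 / 16 = 16 := by norm_num

/-- global reflection types on a rank-2 bundle locally free at the 256 fixed points: balanced (128 same-sign) `L = 32`,
scalar `L = 64`, fibre-traceless `L = 0`; for `F_{A,Z}` and `ρ_a` balanced: `72` both-even smooth points and the `56`
stratum points, `72/4 + 56/4 = 32`; swap type on the stratum `56·1 = 56`; the (D6) minimum `(32 + 32 + 0)/(2·2) − 2 = 14 > 12`. -/
theorem reflection_types :
    (128 : ℚ) / 4 = 32 ∧ (256 : ℚ) / 4 = 64 ∧ (72 : ℚ) / 4 + 56 / 4 = 32 ∧ (56 : ℚ) * 1 = 56 ∧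
    ((32 : ℚ) + 32 + 0) / (2 * 2) - 2 = 14 ∧ (12 : ℚ) < 14 := by norm_num

/-- the Kummer count `2N(2 − 2e₁ + e₂) = 32 + ΣL`, `ΣL = 32(N − c) + 64 c_s`, specialised to `(B1) ∧ SR` (`e₁ = 0`, `e₂ = 12`)
IS the octet equation `N + 8 + 16 c_s = 8 c` — re-derived. -/
theorem b1sr_of_identity (N c cs : ℤ) (h : 2 * N * (2 - 2 * 0 + 12) = 32 + (32 * (N - c) + 64 * cs)) :
    N + 8 + 16 * cs = 8 * c := by omega

/-- and `SR` alone in the untwisted case (`c = N`, `c_s = m'`): `N e₁ + 8 + 16 m' = 7N`. -/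
theorem sr_of_identity (N e1 m : ℤ) (h : 2 * N * (2 + 12) - 4 * (N * e1) = 32 + (32 * (N - N) + 64 * m)) :
    N * e1 + 8 + 16 * m = 7 * N := by omega

/-- OCTET UNIQUENESS, by a route independent of `K2OctetCount.octet_unique` (there: bound `N₂ ≤ 7` + `interval_cases`;
here: `N₂ ∣ 2⁸ ⇒ N₂ = 2^k`, nine linear cases). -/
theorem octet_unique' (N1 N2 c cs : ℕ) (h1 : 1 ≤ N1) (hdvd : N2 ∣ 256) (hc : c = 0 ∨ c = N1)
    (hcs : cs = 0 ∨ 2 * cs = c ∨ cs = c) (h : N1 * N2 + 8 + 16 * cs = 8 * c) :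
    N1 = 2 ∧ N2 = 4 ∧ c = 2 ∧ cs = 0 := by
  have h' : N2 ∣ 2 ^ 8 := by simpa using hdvd
  obtain ⟨k, hk, rfl⟩ := (Nat.dvd_prime_pow Nat.prime_two).1 h'
  interval_cases k <;> norm_num at h ⊢ <;> omega

/-- the octet numerics: `N = 8`, two fibre-traceless `P`-twisted reflections and six balanced ones, `ΣL = 6·32 = 192 = 28·8 − 32`,
`e₂^G − 2e₁^G = (32 + 192)/16 − 2 = 12`. -/
theorem octet_numerics : (2 : ℕ) * 4 = 8 ∧ (6 : ℚ) * 32 + 2 * 0 = 192 ∧ (192 : ℚ) = 28 * 8 - 32 ∧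
    ((32 : ℚ) + 192) / (2 * 8) - 2 = 12 := by norm_num

end HsemiregC4.TracePlate
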